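import Literature.Geometry.Kaehler.ComplexTorusAbelianSurfaceTimesEllipticCurveHodgeGroup
import Literature.Geometry.Kaehler.ComplexTorusSimpleAbelianThreefoldStablyNondegenerate
import HarnessLib

/-!
# Moonen–Zarhin 1999, Thm. (0.1) (4) in dimension `≤ 3` (§5 (5.1)–(5.2)): EVERY complex abelian variety of dimension
# `≤ 3` satisfies condition (D) — `ℬ•(Xⁿ) = 𝒟•(Xⁿ)` for all `n` — and `Hg(X) = Sp_D(V,φ)` (`= S(X)`, connected)

Layer `Literature/Geometry/Kaehler`, namespace `Literature.Geometry.Kaehler.ComplexTorus`; lane `lit-hodgefound`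
(Track 2 foundations library), Layer A4 (known cases of `D = B`), prover seat `lit-hodgefound-p17` (generation 51),
self-proposed row g51-#2 — the ASSEMBLY at torus level of «for every complex abelian variety `X` of dimension `≤ 3` we
have `Hg(X) = Sp_D(V,φ)` and condition (D) in (1.5) is satisfied» from: simple threefolds (g50-#7
`ComplexTorusSimpleAbelianThreefoldStablyNondegenerate`, MZ99 §2 ∕ Thm. (2.5)), `Y × E` for every abelian surface `Y` and
elliptic curve `E` (g51-#1 `ComplexTorusAbelianSurfaceTimesEllipticCurveHodgeGroup`, MZ99 (5.2) + Cor. (3.9)), every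
abelian surface (`ComplexTorusAbelianSurfaceStablyNondegenerate`) and every elliptic curve (Tate), with Poincaré's
complete reducibility (`IsRiemannForm.exists_isIsogenous_prod_of_not_isSimple`).  THEOREMS ONLY (no definition, no
instance, no notation, no named fact; D-0026, net debt 0).

## Sources, VERBATIM (held copies)

* B. J. J. Moonen, Yu. G. Zarhin [MoonenZarhin1999LowDim], *Hodge classes on abelian varieties of low dimension*,
  Math. Ann. **315** (1999), held `paper:arxiv-math_9901113`.  Thm. (0.1) (p0001 L100–L135): «Let `X` be a complex
  abelian variety with `dim(X) ≤ 4` … (4) Suppose we are not in one of the cases (a), (b), (c) or (d). Then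
  `Hg(X) = Sp_D(V,φ)` and `ℬ•(Xⁿ) = 𝒟•(Xⁿ)` for all `n`.» (the cases (a)–(d) are four-dimensional); §5 (5.1)
  (p0008 L73–L92): «Let `X` be a complex abelian variety with `g = dim(X) ≤ 4`. Our first goal is to prove (0.1). As
  recalled above we already know this in case `X` is simple. … Up to isogeny we can decompose `X` as
  `X ∼ Y₁^{m₁} × ⋯ × Y_r^{m_r}` …»; (5.2) (p0008 L101–L111): «Suppose `g = 3`. Suppose also that `X` decomposes, up to
  isogeny, as a product `X ∼ X₁ × X₂` of an elliptic curve `X₁` and a simple abelian surface `X₂`. Then the center of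
  `End⁰(X₂)` does not contain an imaginary quadratic field. By Proposition (3.8) it follows that
  `Hg(X) = Hg(X₁) × Hg(X₂)`. Combining this with Corollary (3.9), we have proven (0.1) in case `dim(X) ≤ 3`. In
  particular, for every complex abelian variety `X` of dimension `≤ 3` we have `Hg(X) = Sp_D(V,φ)` and condition (D)
  in (1.5) is satisfied.»; §1 (1.5) (p0004 L61–L66): «Consider the following condition on the complex abelian variety
  `X`: `ℬ•(Xⁿ) = 𝒟•(Xⁿ)` for all `n` (D). If this condition is satisfied then the Hodge conjecture is “trivially” true
  for all `Xⁿ`.»; §2 (p0005 L16–L22: «type III does not occur for `g ≤ 3`»).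
* J. S. Milne [Milne1999LefschetzClasses], *Lefschetz classes on abelian varieties*, Duke Math. J. 96 (1999), §4
  Prop. 4.8 (stably nondegenerate ⟺ `Hg = L = S`), §2 Summary table.
* B. B. Gordon [Gordon1997], *A survey of the Hodge conjecture for abelian varieties* (held `paper:arxiv-alg-geom_9709030`),
  Thm. 7.5 and 7.6.1–7.6.2.
* H. P. F. Swinnerton-Dyer [SwinnertonDyer1974AbelianVarieties], *Analytic theory of abelian varieties* (1974), Ch. II
  §7 Cor. 3 (a non-simple abelian manifold is isogenous to the product of a subtorus and its complement) — the tree's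
  `IsRiemannForm.exists_isIsogenous_prod_of_not_isSimple`.
* H. Lange [Lange2023AbelianVarietiesComplex], *Abelian Varieties over the Complex Numbers* (2023), §1.1.6 Exercise (1)(a)
  (one-dimensional tori are the `E_τ`), §1.1.2, §2.4.4 (Poincaré).

## Contents

* §1 **`IsRiemannForm.exists_isIsogenous_subtorusPeriod_prod_ellipticPeriod_of_not_isSimple_of_finrank_eq_three`** — a
  NON-simple polarised abelian threefold is isogenous to `Y × E_τ` with `Y` one of its abelian sub-surfaces (a
  Poincaré subtorus, polarised by restriction) and `E_τ` an elliptic curve ((5.1)–(5.2): «`X ∼ X₁ × X₂`»);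
  **`IsRiemannForm.forall_divisorClasses_powPeriod_eq_hodgeClasses_of_not_isSimple_of_finrank_eq_three`** ((D) for it).
* §2 **`IsRiemannForm.forall_divisorClasses_powPeriod_eq_hodgeClasses_of_finrank_eq_three`** — EVERY polarised complex
  abelian threefold satisfies (D): `ℬᵖ(Xᵏ) = 𝒟ᵖ(Xᵏ)` for all `k, p`; the `IsAbelianVariety` form; and «`Hg(X) = Sp_D(V,φ)`»:
  `IsRiemannForm.lefschetzIdentityC_eq_lefschetzGroupC_of_finrank_eq_three` (`S(X)(ℂ)` connected),
  `IsRiemannForm.hodgeGroupC_eq_lefschetzIdentityC_of_finrank_eq_three`, `…hodgeGroupC_eq_lefschetzGroupC…`,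
  **`IsRiemannForm.hodgeGroup_eq_lefschetzGroup_of_finrank_eq_three`** (real points), `…hodgeGroup_eq_lefschetzIdentity…`.
* §3 dimension `≤ 3` in one statement: **`IsRiemannForm.forall_divisorClasses_powPeriod_eq_hodgeClasses_of_finrank_le_three`**,
  `IsAbelianVariety.…`, and **`IsRiemannForm.hodgeGroup_eq_lefschetzGroup_of_finrank_le_three`** with the connectedness
  `IsRiemannForm.lefschetzIdentityC_eq_lefschetzGroupC_of_finrank_le_three` and `…hodgeGroupC_eq_lefschetzGroupC_of_finrank_le_three`.
-/

noncomputable section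

open Module Matrix

namespace Literature.Geometry.Kaehler

namespace ComplexTorus

/-! ## §1 Non-simple abelian threefolds: `X ∼ Y × E` with `Y` an abelian surface and `E` an elliptic curve -/

section NonSimple

variable {κ : Type} [Fintype κ] [DecidableEq κ] {E : Type} [NormedAddCommGroup E] [NormedSpace ℂ E]
  [FiniteDimensional ℂ E] {Ψ : (κ → ℝ) ≃L[ℝ] E} {η : E [⋀^Fin 2]→L[ℝ] ℝ}

/-- **A NON-SIMPLE POLARISED ABELIAN THREEFOLD IS ISOGENOUS TO `Y × E_τ` WITH `Y` AN ABELIAN SURFACE AND `E_τ` AN ELLIPTIC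
CURVE** — `Y = π(V)` one of the two complementary Poincaré subtori of `X` (an abelian sub-surface, polarised by the
restriction of the Riemann form), `E_τ ≅` the other one («Suppose also that `X` decomposes, up to isogeny, as a product
`X ∼ X₁ × X₂` of an elliptic curve `X₁` and a … abelian surface `X₂`» — for `g = 3` every non-simple `X` does).
[cite: MoonenZarhin1999LowDim, §5 (5.1)–(5.2) (p0008 L73–L104)] [cite: SwinnertonDyer1974AbelianVarieties, Ch. II §7 Cor. 3 (pp. 57–58)]
[cite: Lange2023AbelianVarietiesComplex, §1.1.6 Exercise (1)(a) and §2.4.4 Thm. 2.4.25] -/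
theorem IsRiemannForm.exists_isIsogenous_subtorusPeriod_prod_ellipticPeriod_of_not_isSimple_of_finrank_eq_three
    (hη : IsRiemannForm Ψ η) (h3 : finrank ℂ E = 3) (hX : ¬ IsSimple Ψ) :
    ∃ (V : Submodule ℝ (κ → ℝ)) (hV : IsLatticeSubspace V) (hVc : IsComplexSubspace Ψ V) (τ : ℂ) (hτ : τ.im ≠ 0),
      finrank ℂ (cxSpan Ψ V) = 2 ∧ IsIsogenous Ψ (prodPeriod (subtorusPeriod Ψ V hV hVc) (ellipticPeriod hτ)) := by
  obtain ⟨V, hV, hVc, hW, hWc, h1, h2, hiso⟩ := hη.exists_isIsogenous_prod_of_not_isSimple Ψ hX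
  have hcard := hiso.card_eq
  rw [Fintype.card_sum, Fintype.card_fin, Fintype.card_fin, card_eq_two_mul_finrank Ψ, h3] at hcard
  have hV2 := subRank_eq_two_mul_finrank Ψ hV hVc
  have hW2 := subRank_eq_two_mul_finrank Ψ hW hWc
  have hab : (finrank ℂ (cxSpan Ψ V) = 2 ∧ finrank ℂ (cxSpan Ψ (orthSubspace Ψ η V)) = 1) ∨
      (finrank ℂ (cxSpan Ψ V) = 1 ∧ finrank ℂ (cxSpan Ψ (orthSubspace Ψ η V)) = 2) := by omega
  rcases hab with ⟨ha, hb⟩ | ⟨ha, hb⟩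
  · -- `X ∼ π(V) × π(V^⊥)` with `π(V^⊥)` an elliptic curve `≅ E_τ`
    obtain ⟨τ, hτ, e⟩ := exists_isIsomorphic_ellipticPeriod (subtorusPeriod Ψ (orthSubspace Ψ η V) hW hWc) hb
    exact ⟨V, hV, hVc, τ, hτ, ha, IsIsogenous.trans _ _ _ hiso
      ((IsIsomorphic.refl (subtorusPeriod Ψ V hV hVc)).prod e).isIsogenous⟩
  · -- `X ∼ π(V) × π(V^⊥)` with `π(V)` an elliptic curve: swap the factors, `Y = π(V^⊥)`
    obtain ⟨τ, hτ, e⟩ := exists_isIsomorphic_ellipticPeriod (subtorusPeriod Ψ V hV hVc) ha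
    refine ⟨orthSubspace Ψ η V, hW, hWc, τ, hτ, hb, IsIsogenous.trans _ _ _ hiso ?_⟩
    exact ((e.prod (IsIsomorphic.refl (subtorusPeriod Ψ (orthSubspace Ψ η V) hW hWc))).trans
      (isIsomorphic_prodPeriod_comm (ellipticPeriod hτ) (subtorusPeriod Ψ (orthSubspace Ψ η V) hW hWc))).isIsogenous

/-- **MOONEN–ZARHIN (5.2): EVERY NON-SIMPLE POLARISED ABELIAN THREEFOLD SATISFIES CONDITION (D)** — `ℬᵖ(Xᵏ) = 𝒟ᵖ(Xᵏ)` for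
all `k, p`: `X ∼ Y × E_τ` with `Y` a polarised abelian surface (§1), `Y × E_τ` satisfies (D) (g51-#1: (5.2) with
Prop. (3.8) for simple `Y`, Cor. (3.9) for non-simple `Y`), and (D) is an isogeny invariant (Hazama's remarks).
[cite: MoonenZarhin1999LowDim, §5 (5.2) (p0008 L101–L111) and §3 Prop. (3.8), Cor. (3.9)] [cite: Gordon1997, 7.6.1–7.6.2] -/
theorem IsRiemannForm.forall_divisorClasses_powPeriod_eq_hodgeClasses_of_not_isSimple_of_finrank_eq_three
    (hη : IsRiemannForm Ψ η) (h3 : finrank ℂ E = 3) (hX : ¬ IsSimple Ψ) :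
    ∀ k p : ℕ, divisorClasses (powPeriod Ψ k) p = hodgeClasses (powPeriod Ψ k) p := by
  obtain ⟨V, hV, hVc, τ, hτ, h2, hiso⟩ :=
    hη.exists_isIsogenous_subtorusPeriod_prod_ellipticPeriod_of_not_isSimple_of_finrank_eq_three h3 hX
  have hr : subRank V = 4 := by rw [subRank_eq_two_mul_finrank Ψ hV hVc, h2]
  haveI : Nonempty (Fin (subRank V)) := Fin.pos_iff_nonempty.1 (by omega)
  exact hiso.forall_powPeriod_divisorClasses_eq_hodgeClasses_iff.2
    ((isRiemannForm_restrict Ψ hη hV hVc).forall_divisorClasses_powPeriod_prod_ellipticPeriod_eq_hodgeClasses_of_finrank_eq_two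
      hτ h2)

end NonSimple

/-! ## §2 Every complex abelian threefold: condition (D) and `Hg(X) = Sp_D(V,φ) = S(X)` -/

section Threefold

variable {κ : Type} [Fintype κ] [DecidableEq κ] {E : Type} [NormedAddCommGroup E] [NormedSpace ℂ E]
  [FiniteDimensional ℂ E] {Ψ : (κ → ℝ) ≃L[ℝ] E} {η : E [⋀^Fin 2]→L[ℝ] ℝ} {G : Matrix κ κ ℚ}

/-- **MOONEN–ZARHIN, THM. (0.1) (4) IN DIMENSION 3: EVERY POLARISED COMPLEX ABELIAN THREEFOLD SATISFIES CONDITION (D) —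
`ℬᵖ(Xᵏ) = 𝒟ᵖ(Xᵏ)` for every power `Xᵏ` and every codimension `p`** (so «the Hodge conjecture is “trivially” true for all
`Xⁿ`»).  Simple `X`: MZ99 §2 ∕ Thm. (2.5) (g50-#7); non-simple `X`: §1.
[cite: MoonenZarhin1999LowDim, Thm. (0.1) (4) (p0001 L131–L135), §5 (5.1)–(5.2) (p0008 L73–L111: «for every complex abelian variety `X` of dimension `≤ 3` … condition (D) in (1.5) is satisfied») and §1 (1.5) (p0004 L61–L66)]
[cite: Gordon1997, Thm. 7.5 and 7.6.2] -/
theorem IsRiemannForm.forall_divisorClasses_powPeriod_eq_hodgeClasses_of_finrank_eq_three (hη : IsRiemannForm Ψ η)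
    (h3 : finrank ℂ E = 3) : ∀ k p : ℕ, divisorClasses (powPeriod Ψ k) p = hodgeClasses (powPeriod Ψ k) p := by
  haveI : Nonempty κ := Fintype.card_pos_iff.1 (by rw [card_eq_two_mul_finrank Ψ, h3]; norm_num)
  by_cases hX : IsSimple Ψ
  · exact hX.forall_divisorClasses_powPeriod_eq_hodgeClasses_of_finrank_eq_three hη h3
  · exact hη.forall_divisorClasses_powPeriod_eq_hodgeClasses_of_not_isSimple_of_finrank_eq_three h3 hX

/-- **EVERY COMPLEX ABELIAN THREEFOLD SATISFIES CONDITION (D)** (`IsAbelianVariety` form: `ℬ•(Xⁿ) = 𝒟•(Xⁿ)` for every `n`).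
[cite: MoonenZarhin1999LowDim, Thm. (0.1) (4) and §5 (5.2) (p0008 L107–L111)] [cite: Gordon1997, Thm. 7.5] -/
theorem IsAbelianVariety.forall_divisorClasses_powPeriod_eq_hodgeClasses_of_finrank_eq_three (hA : IsAbelianVariety Ψ)
    (h3 : finrank ℂ E = 3) : ∀ k p : ℕ, divisorClasses (powPeriod Ψ k) p = hodgeClasses (powPeriod Ψ k) p := by
  obtain ⟨η, hη⟩ := hA
  exact hη.forall_divisorClasses_powPeriod_eq_hodgeClasses_of_finrank_eq_three h3

/-- **`S(X)(ℂ)` IS CONNECTED FOR EVERY POLARISED ABELIAN THREEFOLD: `Lf(X)(ℂ) = S(X)(ℂ)`** («type III does not occur for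
`g ≤ 3`»; from (D) by the tree's Gordon ∕ Milne criterion). [cite: MoonenZarhin1999LowDim, §2 (p0005 L16–L22) and §5 (5.1) (p0008 L86–L88: «`X` has no factors of Type III»)]
[cite: Milne1999LefschetzClasses, §2 Summary table and §4 Prop. 4.8] -/
theorem IsRiemannForm.lefschetzIdentityC_eq_lefschetzGroupC_of_finrank_eq_three (hη : IsRiemannForm Ψ η)
    (hG : G.map (Rat.cast : ℚ → ℝ) = latticeGram Ψ η) (h3 : finrank ℂ E = 3) :
    lefschetzIdentityC Ψ G = lefschetzGroupC Ψ G :=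
  ((hη.forall_divisorClasses_powPeriod_eq_hodgeClasses_iff_eq_and_hodgeGroupC_eq_lefschetzIdentityC hG (by omega)).1
    (hη.forall_divisorClasses_powPeriod_eq_hodgeClasses_of_finrank_eq_three h3)).1

/-- **`Hg(X)(ℂ) = Lf(X)(ℂ)` FOR EVERY POLARISED ABELIAN THREEFOLD** (stably nondegenerate ⟹ `Hg = Lf`, Gordon's Thm. 7.5 ∕
Milne's Prop. 4.8 in the tree). [cite: MoonenZarhin1999LowDim, §5 (5.2) (p0008 L107–L111: «`Hg(X) = Sp_D(V,φ)`»)] [cite: Milne1999LefschetzClasses, §4 Prop. 4.8]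
[cite: Gordon1997, Thm. 7.5] -/
theorem IsRiemannForm.hodgeGroupC_eq_lefschetzIdentityC_of_finrank_eq_three (hη : IsRiemannForm Ψ η)
    (hG : G.map (Rat.cast : ℚ → ℝ) = latticeGram Ψ η) (h3 : finrank ℂ E = 3) :
    hodgeGroupC Ψ = lefschetzIdentityC Ψ G :=
  ((hη.forall_divisorClasses_powPeriod_eq_hodgeClasses_iff_eq_and_hodgeGroupC_eq_lefschetzIdentityC hG (by omega)).1
    (hη.forall_divisorClasses_powPeriod_eq_hodgeClasses_of_finrank_eq_three h3)).2

/-- **`Hg(X)(ℂ) = S(X)(ℂ)` for every polarised abelian threefold** (Milne's full centraliser of `End⁰(X)` in `Sp(V,E)`, complex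
points). [cite: MoonenZarhin1999LowDim, §5 (5.2) (p0008 L107–L111)] [cite: Milne1999LefschetzClasses, §4 Prop. 4.8] -/
theorem IsRiemannForm.hodgeGroupC_eq_lefschetzGroupC_of_finrank_eq_three (hη : IsRiemannForm Ψ η)
    (hG : G.map (Rat.cast : ℚ → ℝ) = latticeGram Ψ η) (h3 : finrank ℂ E = 3) :
    hodgeGroupC Ψ = lefschetzGroupC Ψ G := by
  rw [hη.hodgeGroupC_eq_lefschetzIdentityC_of_finrank_eq_three hG h3,
    hη.lefschetzIdentityC_eq_lefschetzGroupC_of_finrank_eq_three hG h3]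

/-- **MOONEN–ZARHIN: «`Hg(X) = Sp_D(V,φ)`» FOR EVERY COMPLEX ABELIAN THREEFOLD — real points: `Hg(X)(ℝ) = S(X)(ℝ)`**
(`= lefschetzGroup Ψ η`, the centraliser of `D = End⁰(X)` in the symplectic group of the polarisation).
[cite: MoonenZarhin1999LowDim, Thm. (0.1) (4) (p0001 L131–L135) and §5 (5.2) (p0008 L107–L111: «for every complex abelian variety `X` of dimension `≤ 3` we have `Hg(X) = Sp_D(V,φ)`»)]
[cite: Milne1999LefschetzClasses, §4 Prop. 4.8] [cite: Gordon1997, Thm. 7.5] -/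
theorem IsRiemannForm.hodgeGroup_eq_lefschetzGroup_of_finrank_eq_three (hη : IsRiemannForm Ψ η)
    (h3 : finrank ℂ E = 3) : hodgeGroup Ψ = lefschetzGroup Ψ η := by
  obtain ⟨G, hG⟩ := hη.exists_ratMatrix_latticeGram
  exact ((hη.forall_divisorClasses_powPeriod_eq_hodgeClasses_iff_eq_and_hodgeGroup_eq_lefschetzGroup hG (by omega)).1
    (hη.forall_divisorClasses_powPeriod_eq_hodgeClasses_of_finrank_eq_three h3)).2

/-- **`Hg(X)(ℝ) = Lf(X)(ℝ)` for every polarised abelian threefold** (`S(X)` is connected, so `Lf = S` on real points too).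
[cite: MoonenZarhin1999LowDim, §5 (5.2) (p0008 L107–L111)] [cite: Milne1999LefschetzClasses, §4 Prop. 4.8 and §2 Summary table] -/
theorem IsRiemannForm.hodgeGroup_eq_lefschetzIdentity_of_finrank_eq_three (hη : IsRiemannForm Ψ η)
    (hG : G.map (Rat.cast : ℚ → ℝ) = latticeGram Ψ η) (h3 : finrank ℂ E = 3) :
    hodgeGroup Ψ = lefschetzIdentity Ψ G :=
  (hη.forall_divisorClasses_powPeriod_eq_hodgeClasses_iff_hodgeGroup_eq_lefschetzIdentity_of_eq hG (by omega)
    (hη.lefschetzIdentityC_eq_lefschetzGroupC_of_finrank_eq_three hG h3)).1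
    (hη.forall_divisorClasses_powPeriod_eq_hodgeClasses_of_finrank_eq_three h3)

end Threefold

/-! ## §3 «For every complex abelian variety `X` of dimension `≤ 3`»: condition (D) and `Hg(X) = Sp_D(V,φ)` -/

section LowDimension

variable {κ : Type} [Fintype κ] [DecidableEq κ] {E : Type} [NormedAddCommGroup E] [NormedSpace ℂ E]
  [FiniteDimensional ℂ E] {Ψ : (κ → ℝ) ≃L[ℝ] E} {η : E [⋀^Fin 2]→L[ℝ] ℝ} {G : Matrix κ κ ℚ}

/-- **MOONEN–ZARHIN, THM. (0.1) IN DIMENSION `≤ 3`: EVERY (non-zero) POLARISED COMPLEX ABELIAN VARIETY OF DIMENSION `≤ 3`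
SATISFIES CONDITION (D)** — `ℬᵖ(Xᵏ) = 𝒟ᵖ(Xᵏ)` for all `k, p` (dimension `1`: `X ≅ E_τ`, Tate; `2`: the tree's
`ComplexTorusAbelianSurfaceStablyNondegenerate`; `3`: §2).
[cite: MoonenZarhin1999LowDim, Thm. (0.1) (4) (p0001 L131–L135) and §5 (5.2) (p0008 L107–L111), Introduction (p0001 L62–L64)]
[cite: vanGeemen1994HodgeAV, §4 Thm. 4.3] [cite: Gordon1997, Thm. 7.5] -/
theorem IsRiemannForm.forall_divisorClasses_powPeriod_eq_hodgeClasses_of_finrank_le_three (hη : IsRiemannForm Ψ η)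
    (h0 : 0 < finrank ℂ E) (h3 : finrank ℂ E ≤ 3) :
    ∀ k p : ℕ, divisorClasses (powPeriod Ψ k) p = hodgeClasses (powPeriod Ψ k) p := by
  haveI : Nonempty κ := Fintype.card_pos_iff.1 (by rw [card_eq_two_mul_finrank Ψ]; omega)
  interval_cases h : finrank ℂ E
  · obtain ⟨τ, hτ, e⟩ := exists_isIsomorphic_ellipticPeriod Ψ h
    exact e.isIsogenous.forall_powPeriod_divisorClasses_eq_hodgeClasses_iff.2
      fun k p ↦ divisorClasses_eq_hodgeClasses_ellipticPow hτ k p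
  · exact hη.divisorClasses_powPeriod_eq_hodgeClasses_of_finrank_eq_two h
  · exact hη.forall_divisorClasses_powPeriod_eq_hodgeClasses_of_finrank_eq_three h

/-- **Every complex abelian variety of dimension `1`, `2` or `3` satisfies condition (D)** (`IsAbelianVariety` form).
[cite: MoonenZarhin1999LowDim, Thm. (0.1) (4) and §5 (5.2) (p0008 L107–L111)] [cite: Gordon1997, Thm. 7.5] -/
theorem IsAbelianVariety.forall_divisorClasses_powPeriod_eq_hodgeClasses_of_finrank_le_three (hA : IsAbelianVariety Ψ)
    (h0 : 0 < finrank ℂ E) (h3 : finrank ℂ E ≤ 3) :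
    ∀ k p : ℕ, divisorClasses (powPeriod Ψ k) p = hodgeClasses (powPeriod Ψ k) p := by
  obtain ⟨η, hη⟩ := hA
  exact hη.forall_divisorClasses_powPeriod_eq_hodgeClasses_of_finrank_le_three h0 h3

/-- **`S(X)(ℂ)` is connected for every polarised abelian variety of dimension `≤ 3`** («type III does not occur for
`g ≤ 3`»). [cite: MoonenZarhin1999LowDim, §2 (p0005 L16–L22) and §5 (5.1)–(5.2)] [cite: Milne1999LefschetzClasses, §2 Summary table and §4 Prop. 4.8] -/
theorem IsRiemannForm.lefschetzIdentityC_eq_lefschetzGroupC_of_finrank_le_three (hη : IsRiemannForm Ψ η)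
    (hG : G.map (Rat.cast : ℚ → ℝ) = latticeGram Ψ η) (h0 : 0 < finrank ℂ E) (h3 : finrank ℂ E ≤ 3) :
    lefschetzIdentityC Ψ G = lefschetzGroupC Ψ G :=
  ((hη.forall_divisorClasses_powPeriod_eq_hodgeClasses_iff_eq_and_hodgeGroupC_eq_lefschetzIdentityC hG h0).1
    (hη.forall_divisorClasses_powPeriod_eq_hodgeClasses_of_finrank_le_three h0 h3)).1

/-- **`Hg(X)(ℂ) = S(X)(ℂ)` for every polarised abelian variety of dimension `≤ 3`.**
[cite: MoonenZarhin1999LowDim, §5 (5.2) (p0008 L107–L111)] [cite: Milne1999LefschetzClasses, §4 Prop. 4.8] -/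
theorem IsRiemannForm.hodgeGroupC_eq_lefschetzGroupC_of_finrank_le_three (hη : IsRiemannForm Ψ η)
    (hG : G.map (Rat.cast : ℚ → ℝ) = latticeGram Ψ η) (h0 : 0 < finrank ℂ E) (h3 : finrank ℂ E ≤ 3) :
    hodgeGroupC Ψ = lefschetzGroupC Ψ G := by
  have h := (hη.forall_divisorClasses_powPeriod_eq_hodgeClasses_iff_eq_and_hodgeGroupC_eq_lefschetzIdentityC hG h0).1
    (hη.forall_divisorClasses_powPeriod_eq_hodgeClasses_of_finrank_le_three h0 h3)
  rw [h.2, h.1]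

/-- **MOONEN–ZARHIN: «FOR EVERY COMPLEX ABELIAN VARIETY `X` OF DIMENSION `≤ 3` WE HAVE `Hg(X) = Sp_D(V,φ)`»** — real points:
`Hg(X)(ℝ) = S(X)(ℝ)`, the centraliser of `D = End⁰(X)` in the symplectic group of any polarisation `φ`.
[cite: MoonenZarhin1999LowDim, Thm. (0.1) (4) (p0001 L131–L135) and §5 (5.2) (p0008 L107–L111)] [cite: Milne1999LefschetzClasses, §4 Prop. 4.8]
[cite: Gordon1997, Thm. 7.5] -/
theorem IsRiemannForm.hodgeGroup_eq_lefschetzGroup_of_finrank_le_three (hη : IsRiemannForm Ψ η)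
    (h0 : 0 < finrank ℂ E) (h3 : finrank ℂ E ≤ 3) : hodgeGroup Ψ = lefschetzGroup Ψ η := by
  obtain ⟨G, hG⟩ := hη.exists_ratMatrix_latticeGram
  exact ((hη.forall_divisorClasses_powPeriod_eq_hodgeClasses_iff_eq_and_hodgeGroup_eq_lefschetzGroup hG h0).1
    (hη.forall_divisorClasses_powPeriod_eq_hodgeClasses_of_finrank_le_three h0 h3)).2

end LowDimension

end ComplexTorus

end Literature.Geometry.Kaehler
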